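import Literature.MathematicalPhysics.QuantumFieldTheory.Balaban1983to89.Node00.CarriersZSectE
import Literature.MathematicalPhysics.QuantumFieldTheory.Balaban1983to89.Node00.CriticalOfRecord
import Literature.MathematicalPhysics.QuantumFieldTheory.Balaban1983to89.B11LeafKnitProp9
import Literature.MathematicalPhysics.QuantumFieldTheory.Balaban1983to89.B11Prop9ModelNonVacuity

/-!
# NODE 00 (YM-PLAN Track A) — THE SECT. G PRESENTATION OF THE [Balaban1985Variational] GROUP OF RECORD: the Prop. 9 family `famAn` of the residual layer
# `ResidZ` PRESENTED through n07-b's Sect. E–G model datum AT NODE 00's OBJECTS (bond algebra `M_N(ℂ)`, the bonds of `𝔅_k = T⁽ᵏ⁾` of the `K`-th approximation,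
# the boundary data `V₀` of record), so that the leaf conjunct p9 (Proposition 9) at the bundle of record is a THEOREM BY NAME; record-level use BY
# SUBSTITUTION `ζ := ζ₀.withSectG G` (no new key); the combination with def-B11's Sect. E presentation and with the criticality pin; what stays residual, said

NODE 00 CARRIER MODULE (seat `pub-ymgap-dag-n07-e` g4, 2026-08-27; the companion of `Node00/CarriersZSectE` (seat `pub-ymgap-node00-def-B11` g2, p462651) for
the OTHER presented family — def-B11 g0's successor design «Z′» (`B11-PIN-ANSWER.md` §3: `sectG : ∀ i, SectGDatum q …`, `famAn i := (sectG i).toAnData`,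
`p9 := B11LeafKnitProp9.prop9_conjunct_of_model`) restricted to the Prop. 9 slot, the Sect. E slot being def-B11's module).  APPEND-ONLY: a NEW importing module;
`CarriersZ`, `CarriersZSectE`, `CriticalOfRecord`, n07-b's `B11Prop9Model` ∕ `B11Prop9ModelNonVacuity` and n07-a's `B11LeafKnitProp9` are untouched and CONSUMED BY
NAME.  [Balaban1985Variational] = T. Bałaban, *The variational problem and background fields in renormalization group method for lattice gauge theories*,
Commun. Math. Phys. **102** (1985) 277–309 (cell paper B11); Sect. G = pp. 305–309, Proposition 9 = p. 309.

WHY.  At a record of `CarriersZ` the B11 carrier group IS `Z11OfRecord F N ζ`; its Prop. 9 family `ζ.famAn : ZIdx → B11.AnData` is RESIDUAL DATA (no law), so the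
leaf conjunct p9 reads free data.  n07-b typed Bałaban's Sect. G as ONE model datum `B11Prop9Model.SectGDatum q 𝔄 ι 𝒴 𝒵 Bdry` (the multiscale geometry of `𝔅_k`,
the operators `G̃, (δ/δA′)V, Δ⁽²⁾, H₀, H, D` at the background `U_k(V₀)`, the block sizes of (190)) sharing the printed constants `q : GConsts`, with
`SectGDatum.toAnData` producing the `AnData` the typed Proposition 9 reads and `prop9Printed_model_of_le` PROVING `B11.Prop9Printed` ON THAT FAMILY (every clause
a theorem: `hDet_model`, `hAnalytic_model`, `norm_chart_lt`, `extAnalytic_model`, `extOrbits_model`, `ineq190_model`); n07-a's `B11LeafKnitProp9` turned it into the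
leaf conjunct p9 of ANY bundle whose `famAn` is such a family with coherent letters (`Z.C₁ = q.C₁`, `Z.β₀ = q.β₀`, `Z.δ₀ = q.δ₀`, `q.B5 ≤ Z.B₅` — referee ref-C READ #15
condition (f)).  THIS MODULE IS THAT PIN, at NODE 00's objects: `𝔄 := Matrix (Fin N) (Fin N) ℂ` (the fibre algebra of record, `SU N ⊆ M_N(ℂ) ⊇ Gᶜ`, Mathlib's
L²-operator norm — the reading of `B11Eq172LogBound` ∕ `B11SectGAnalyticV`), `ι := PBond (F.P K) k` (the positively oriented bonds of `𝔅_k = T⁽ᵏ⁾`, the `k`-lattice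
of the `K`-th approximation, no holes — so `ι → 𝔄` IS the space of the configurations `B`, `V′` on `𝔅_k` of (172)), `Bdry := GaugeField (F.P K) k (SU N)` (the boundary
data `V₀` of record, the SAME type as the Props 7–8 family's `Bdry`), and the two complex Banach spaces of the model — the space (115) and the space of `|·|₍₋₃₎` —
carried as PARAMETER families `𝒴 𝒵 : ZIdx → Type` with their instance BINDERS, exactly as `L`, `η`, `β` are parameters of `SectEPres` (at NODE 00 the space (115)
of record is background-indexed, `B11Eq115Space.Space115 L η lev₀ lev₁ (nabla115 η U₀)`, while the model fixes one pair of spaces per member: the pair is the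
consumer's choice).

WHAT.  §1 `SectGPres F N 𝒴 𝒵 ζ` = a Sect. G presentation of `ζ`'s Prop. 9 family: shared constants `q` with `q.Valid`, the four coherence identities with the
bundle's letters, and per member a Sect. G datum `D i`; `ResidZ.withSectG ζ G` = `ζ` with `famAn := fun i ↦ (G.D i).toAnData` (everything else — `R`, `IsCrit`,
`famLG`, the constants — unchanged, `rfl`); the transports `SectGPres.onWithSectE ∕ onPinCrit`, `SectEPres.onWithSectG` (the three refinements touch DISJOINT
fields and never the constants) and the combined refinement `ResidZ.withSectEG ζ E G := (ζ.withSectE E).withSectG (G.onWithSectE E)` with its faces and the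
commutation lemmas (`rfl`).  §2 AT THE BUNDLE OF RECORD: ★ `prop9_Z11OfRecord_withSectG` — p9 IS A THEOREM (`B11LeafKnitProp9.prop9_conjunct_of_model`, `hfam := rfl`);
`b11Leaf_Z11OfRecord_withSectG_of_parts` (the leaf from the EIGHT remaining parts + n16's dictionary, `B11LeafKnitProp9.b11Leaf_of_parts_prop9Model`); at the
combined layer `prop4_ ∕ prop6_ ∕ prop9_Z11OfRecord_withSectEG` and ★ `b11Leaf_Z11OfRecord_withSectEG_of_parts` — the leaf from Props 2, 3, 5, 8, Sect. F and the
dictionary inputs ONLY (p4, p6, p9 no longer inputs).  §3 NON-VACUITY BY CONSTRUCTION: `zeroConsts ∕ zeroDatum` (the DEGENERATE datum — every operator `0`, the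
one-site geometry and the norm sizes of `B11Prop9ModelNonVacuity`; NOT Bałaban's operators — honest), `zeroDatum_letters` (its located leaves hold at every `V₀`, so
the presented p9 is exercised, not vacuous), `exists_sectGPres` (every layer with `0 < C₁`, `0 ≤ δ₀`, `4 ≤ B₅` admits a presentation; print's `B₅ = 6B₁B₃C₁` with
`C₁ = L³`), `exists_sectEPres_and_sectGPres`; HONESTY `exists_withSectG_not_b11Leaf`, `exists_withSectEG_not_b11Leaf`: the junk channel of the ∀-form (the residual
regularity data `ζ.R` of (9)–(10), `CarriersZ.exists_residZ_not_b11Leaf`) SURVIVES both presentations — interface finding F8 (the gauge-fixed pin of `R`) stays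
unowned and untouched.

DECLARED READING (carried verbatim from `B11Prop9Model`, reading (R7); nothing new): the presented family's `Reg7 ε₁ V₀ := (G.D i).Letters V₀` — hypothesis (7) for
`V₀` is READ as the located operator leaves at the background `U_k(V₀)` (p. 309 *«U satisfying the regularity conditions (3.35)–(3.38) [5], or (1.7)–(1.9) [6]»*;
print uses (7) for `V₀` only through Theorem 1), so the theorem `prop9_Z11OfRecord_withSectG` asserts Proposition 9's conclusions OF THE DATUM'S OPERATORS at every
`V₀` carrying those leaves; (R1)–(R6) likewise as in `B11Prop9Model.SectGDatum.toAnData`.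
WHAT STAYS RESIDUAL, EXPLICITLY: (a) `ζ.R` (F8; unowned); (b) `ζ.IsCrit` unless pinned (`CriticalOfRecord.ResidZ.pinCrit`, composable here: `onPinCrit`,
`pinCrit_withSectG`); (c) INSIDE the Sect. G datum, the geometry `g` and the operators `𝒢, W, D2, H₀, H, D` with their block sizes are DATA of the presentation (which
background they come from is data — n07-b's design), and the located leaves `Letters V₀` are the reading of (7), never asserted; (d) the spaces `𝒴 i`, `𝒵 i` are the
consumer's parameters.  HONEST FRAMING: definitions + kernel bookkeeping; NO estimate; nothing of [Balaban1985Variational] asserted; N07 NOT discharged (NODE 00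
presents, N07 books — in ∃-currency at a NAMED `(ζ, E, G)`, the ∀-form staying junk-refutable through `ζ.R`); counts unmoved (5∕27); one finite T⁴ programme at fixed ε
— NOT continuum ∕ ℝ⁴ ∕ infinite volume ∕ OS ∕ mass gap ∕ Clay.  No `sorry`, no `axiom`, no `opaque`, no `instance`, no `notation`.  Filed `--supports
stmt-QuantumFields-19903` (K1′, nodes N01–N13). -/

noncomputable section

namespace Literature.MathematicalPhysics.QuantumFieldTheory.Balaban1983to89.Node00

open T4Continuum DagBinding
open B11 (Prop2Printed Prop3Printed Prop4Printed Prop5Printed Prop6Printed Prop8Printed SectFPrinted Prop9Printed)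
open B11Thm1CarrierT (RegCarrierT varProblemT)
open B11Prop7Assembly (Bridge ExistenceLeavesCap)
open B11Prop9Model (GConsts SectGDatum)
open B11SectG (BlockNorm HasMaj)
open B11Prop9ModelNonVacuity (toyGeometry normBlockNorm)
open scoped Matrix.Norms.L2Operator

/-! ## §1. The Sect. G presentation of a residual layer's Prop. 9 family at NODE 00's objects -/

section Pres

variable (F : T4Family) (N : ℕ)
variable (𝒴 𝒵 : ZIdx → Type) [∀ i, NormedAddCommGroup (𝒴 i)] [∀ i, NormedSpace ℂ (𝒴 i)] [∀ i, CompleteSpace (𝒴 i)]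
  [∀ i, NormedAddCommGroup (𝒵 i)] [∀ i, NormedSpace ℂ (𝒵 i)] [∀ i, CompleteSpace (𝒵 i)]

/-- **A SECT. G PRESENTATION of the Prop. 9 family of a residual layer `ζ` AT NODE 00's OBJECTS**: the printed constants `q` shared by the family (p. 279 *«The
constants … depend on d and L only»*) with their sign ∕ smallness conditions `q.Valid` ((187)), the four coherence identities with the bundle's letters
(`C₁` of (14)∕(172), `β₀` of (9)∕(190), `δ₀` of (190), and `q.B5 ≤ ζ.B₅` — print's `B₅ = 6B₁B₃C₁` of (173) when larger; referee condition (f)), and, per member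
`i = ⟨K, k, _⟩`, n07-b's Sect. G datum over the bond algebra `M_N(ℂ)`, the bonds `PBond (F.P K) k` of `𝔅_k = T⁽ᵏ⁾`, the spaces `𝒴 i`, `𝒵 i`, and the boundary data
`V₀ : GaugeField (F.P K) k (SU N)` of record.  Data + coherence, no law beyond the datum's own fields. [cite: Balaban1985Variational, Sect. G (170)–(190) pp.305–308, Prop. 9 p.309, (173) p.305] -/
structure SectGPres (ζ : ResidZ F N) where
  /-- the printed constants shared by the family -/
  q : GConsts
  /-- their sign conditions and the located smallness of (187) -/
  valid : q.Valid
  /-- coherence with the bundle's `C₁` ((14), (172)) -/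
  hC₁ : ζ.C₁ = q.C₁
  /-- coherence with the bundle's Hölder range `β₀` ((9), (190)) -/
  hβ₀ : ζ.β₀ = q.β₀
  /-- coherence with the bundle's decay rate `δ₀` ((190)) -/
  hδ₀ : ζ.δ₀ = q.δ₀
  /-- the model's `B₅ = 2(λ + α)` does not exceed the bundle's `B₅` ((173)) -/
  hB₅ : q.B5 ≤ ζ.B₅
  /-- the Sect. G datum of member `i`, at NODE 00's objects -/
  D : ∀ i : ZIdx, SectGDatum q (Matrix (Fin N) (Fin N) ℂ) (PBond (F.P i.K) i.k) (𝒴 i) (𝒵 i) (GaugeField (F.P i.K) i.k (SU N))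

variable {F N 𝒴 𝒵}

/-- **THE PRESENTED RESIDUAL LAYER**: `ζ` with its Prop. 9 family REPLACED by the Sect. G model family `fun i ↦ (G.D i).toAnData`
(`B11Prop9Model.SectGDatum.toAnData`, readings (R1)–(R7) there); `R`, `IsCrit`, `famLG` and the twelve constants unchanged. [cite: Balaban1985Variational, Prop. 9 p.309 (the carrier the typed statement reads)] -/
def ResidZ.withSectG (ζ : ResidZ F N) (G : SectGPres F N 𝒴 𝒵 ζ) : ResidZ F N :=
  { ζ with famAn := fun i => (G.D i).toAnData }

/-- The presented layer's Prop. 9 family IS the Sect. G model family (`rfl`). [cite: Balaban1985Variational, Prop. 9 p.309 (bookkeeping)] -/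
theorem ResidZ.withSectG_famAn (ζ : ResidZ F N) (G : SectGPres F N 𝒴 𝒵 ζ) : (ζ.withSectG G).famAn = fun i => (G.D i).toAnData := rfl

/-- The presentation leaves the regularity data of (9)–(10) unchanged (`rfl`). [cite: Balaban1985Variational, (9)–(10) p.279 (bookkeeping)] -/
theorem ResidZ.withSectG_R (ζ : ResidZ F N) (G : SectGPres F N 𝒴 𝒵 ζ) : (ζ.withSectG G).R = ζ.R := rfl

/-- The presentation leaves the criticality predicate unchanged (`rfl`). [cite: Balaban1985Variational, Props 7–8 pp.299–304 (bookkeeping)] -/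
theorem ResidZ.withSectG_IsCrit (ζ : ResidZ F N) (G : SectGPres F N 𝒴 𝒵 ζ) : (ζ.withSectG G).IsCrit = ζ.IsCrit := rfl

/-- The presentation leaves the Props 2–6 family unchanged (`rfl`). [cite: Balaban1985Variational, Props 2–6 pp.281–296 (bookkeeping)] -/
theorem ResidZ.withSectG_famLG (ζ : ResidZ F N) (G : SectGPres F N 𝒴 𝒵 ζ) : (ζ.withSectG G).famLG = ζ.famLG := rfl

/-- The member datum's reading of hypothesis (7) for `V₀` IS its located leaves `Letters V₀` (reading (R7) of `B11Prop9Model`, `Iff.rfl`) — said here so that no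
consumer mistakes the presented p9 for a statement conditioned on `PlaqSmall`. [cite: Balaban1985Variational, (7) p.278, Prop. 9 p.309 («U satisfying the regularity conditions (3.35)–(3.38) [5]»)] -/
theorem ResidZ.withSectG_reg7_iff (ζ : ResidZ F N) (G : SectGPres F N 𝒴 𝒵 ζ) (i : ZIdx) (ε₁ : ℝ) (V₀ : GaugeField (F.P i.K) i.k (SU N)) :
    ((ζ.withSectG G).famAn i).Reg7 ε₁ V₀ ↔ (G.D i).Letters V₀ := Iff.rfl

section Crit

variable [NeZero N]

/-- A Sect. G presentation of `ζ` presents `ζ.pinCrit` as well (the pin touches `IsCrit` only; same constants). [cite: Balaban1985Variational, Props 7–9 pp.299–309 (bookkeeping)] -/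
def SectGPres.onPinCrit {ζ : ResidZ F N} (G : SectGPres F N 𝒴 𝒵 ζ) : SectGPres F N 𝒴 𝒵 ζ.pinCrit :=
  ⟨G.q, G.valid, G.hC₁, G.hβ₀, G.hδ₀, G.hB₅, G.D⟩

/-- Pinning «critical» and presenting Sect. G commute (`rfl`). [cite: Balaban1985Variational, Props 7–9 pp.299–309 (bookkeeping)] -/
theorem ResidZ.pinCrit_withSectG (ζ : ResidZ F N) (G : SectGPres F N 𝒴 𝒵 ζ) : (ζ.withSectG G).pinCrit = ζ.pinCrit.withSectG G.onPinCrit := rfl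

/-- n07-e g2's criticality pin presents through def-B11's Sect. E presentation as well (the pin touches `IsCrit` only; the datum reads `ζ.B₀`, `ζ.B₃`).
[cite: Balaban1985Variational, Props 2–8 pp.281–304 (bookkeeping)] -/
def SectEPres.onPinCrit {L : ℝ} {η : ZIdx → ℝ} [Fact (0 < L)] [∀ i, Fact (0 < η i)] {β : ZIdx → Type} [∀ i, Fintype (β i)] {ζ : ResidZ F N}
    (E : SectEPres F N L η β ζ) : SectEPres F N L η β ζ.pinCrit :=
  ⟨E.C₄, E.a₃, E.α, E.D, E.R⟩

end Crit

section WithE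

variable {L : ℝ} {η : ZIdx → ℝ} [Fact (0 < L)] [∀ i, Fact (0 < η i)] {β : ZIdx → Type} [∀ i, Fintype (β i)]

/-- A Sect. G presentation of `ζ` presents def-B11's Sect.-E-presented layer `ζ.withSectE E` as well (disjoint fields; same constants).
[cite: Balaban1985Variational, Props 2–6 pp.281–296 and Prop. 9 p.309 (bookkeeping)] -/
def SectGPres.onWithSectE {ζ : ResidZ F N} (G : SectGPres F N 𝒴 𝒵 ζ) (E : SectEPres F N L η β ζ) : SectGPres F N 𝒴 𝒵 (ζ.withSectE E) :=
  ⟨G.q, G.valid, G.hC₁, G.hβ₀, G.hδ₀, G.hB₅, G.D⟩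

/-- A Sect. E presentation of `ζ` presents the Sect.-G-presented layer `ζ.withSectG G` as well (its data read `ζ.B₀`, `ζ.B₃` only).
[cite: Balaban1985Variational, Props 2–6 pp.281–296 and Prop. 9 p.309 (bookkeeping)] -/
def SectEPres.onWithSectG {ζ : ResidZ F N} (E : SectEPres F N L η β ζ) (G : SectGPres F N 𝒴 𝒵 ζ) : SectEPres F N L η β (ζ.withSectG G) :=
  ⟨E.C₄, E.a₃, E.α, E.D, E.R⟩

/-- **THE DOUBLY-PRESENTED RESIDUAL LAYER**: `ζ` with its Props 2–6 family presented through def-B11's Sect. E datum `E` AND its Prop. 9 family presented through the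
Sect. G datum `G`. [cite: Balaban1985Variational, Props 2–6 pp.281–296, Prop. 9 p.309 (the carriers the typed statements read)] -/
def ResidZ.withSectEG (ζ : ResidZ F N) (E : SectEPres F N L η β ζ) (G : SectGPres F N 𝒴 𝒵 ζ) : ResidZ F N :=
  (ζ.withSectE E).withSectG (G.onWithSectE E)

/-- The two presentations commute (`rfl`). [cite: Balaban1985Variational, Props 2–9 pp.281–309 (bookkeeping)] -/
theorem ResidZ.withSectEG_eq_withSectG_withSectE (ζ : ResidZ F N) (E : SectEPres F N L η β ζ) (G : SectGPres F N 𝒴 𝒵 ζ) :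
    ζ.withSectEG E G = (ζ.withSectG G).withSectE (E.onWithSectG G) := rfl

/-- Faces of the doubly-presented layer (`rfl` ×4): the Sect. E family, the Sect. G family, `R` and `IsCrit` unchanged.
[cite: Balaban1985Variational, Props 2–9 pp.281–309 (bookkeeping)] -/
theorem ResidZ.withSectEG_faces (ζ : ResidZ F N) (E : SectEPres F N L η β ζ) (G : SectGPres F N 𝒴 𝒵 ζ) :
    (ζ.withSectEG E G).famLG = (fun i => (E.D i).toLGData (E.R i) ζ.C₁) ∧ (ζ.withSectEG E G).famAn = (fun i => (G.D i).toAnData) ∧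
      (ζ.withSectEG E G).R = ζ.R ∧ (ζ.withSectEG E G).IsCrit = ζ.IsCrit :=
  ⟨rfl, rfl, rfl, rfl⟩

/-- The doubly-presented layer of `ζ.pinCrit` IS the crit-pinned doubly-presented layer (`rfl`): all three refinements commute.
[cite: Balaban1985Variational, Props 2–9 pp.281–309 (bookkeeping)] -/
theorem ResidZ.pinCrit_withSectEG [NeZero N] (ζ : ResidZ F N) (E : SectEPres F N L η β ζ) (G : SectGPres F N 𝒴 𝒵 ζ) :
    (ζ.withSectEG E G).pinCrit = ζ.pinCrit.withSectEG E.onPinCrit G.onPinCrit := rfl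

end WithE

end Pres

/-! ## §2. At the bundle of record: p9 is a theorem; the leaf from the remaining printed parts; with Sect. E presented too, p4, p6, p9 are theorems -/

section AtBundle

variable {F : T4Family} {N : ℕ} [NeZero N]
variable {𝒴 𝒵 : ZIdx → Type} [∀ i, NormedAddCommGroup (𝒴 i)] [∀ i, NormedSpace ℂ (𝒴 i)] [∀ i, CompleteSpace (𝒴 i)]
  [∀ i, NormedAddCommGroup (𝒵 i)] [∀ i, NormedSpace ℂ (𝒵 i)] [∀ i, CompleteSpace (𝒵 i)]

/-- The bundle of record at a presented layer has the Sect. G model family as its Prop. 9 family (`rfl`) — the hypothesis `hfam` of n07-a's `B11LeafKnitProp9`.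
[cite: Balaban1985Variational, Prop. 9 p.309 (bookkeeping)] -/
theorem Z11OfRecord_withSectG_famAn (ζ : ResidZ F N) (G : SectGPres F N 𝒴 𝒵 ζ) :
    (Z11OfRecord F N (ζ.withSectG G)).famAn = fun i => (G.D i).toAnData := rfl

/-- The Theorem-1, Props 7–8 ∕ Sect. F and Props 2–6 families of the bundle of record are UNCHANGED by the presentation (`rfl` ×3).
[cite: Balaban1985Variational, Thm 1 p.279, Props 2–8 pp.281–304 (bookkeeping)] -/
theorem Z11OfRecord_withSectG_famV_famX_famLG (ζ : ResidZ F N) (G : SectGPres F N 𝒴 𝒵 ζ) :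
    (Z11OfRecord F N (ζ.withSectG G)).famV = (Z11OfRecord F N ζ).famV ∧ (Z11OfRecord F N (ζ.withSectG G)).famX = (Z11OfRecord F N ζ).famX ∧
      (Z11OfRecord F N (ζ.withSectG G)).famLG = (Z11OfRecord F N ζ).famLG :=
  ⟨rfl, rfl, rfl⟩

/-- ★ **THE LEAF CONJUNCT p9 (PROPOSITION 9, p. 309) AT THE BUNDLE OF RECORD IS A THEOREM**: at `Z11OfRecord F N (ζ.withSectG G)`,
`B11.Prop9Printed ζ.B₅ ζ.C₁ ζ.β₀ ζ.δ₀ _` — n07-a's `B11LeafKnitProp9.prop9_conjunct_of_model` (n07-b's `prop9Printed_model_of_le`: O(1) := `O1 q` and the threshold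
«ε₁ sufficiently small» := `cthr q` chosen BEFORE the member) BY NAME, `hfam := rfl`, the coherence from `G`.  Declared reading (R7): the premise (7) of each member reads
`(G.D i).Letters V₀`. [cite: Balaban1985Variational, Prop. 9 p.309; (173) p.305] -/
theorem prop9_Z11OfRecord_withSectG (ζ : ResidZ F N) (G : SectGPres F N 𝒴 𝒵 ζ) :
    Prop9Printed ζ.B₅ ζ.C₁ ζ.β₀ ζ.δ₀ (Z11OfRecord F N (ζ.withSectG G)).famAn :=
  B11LeafKnitProp9.prop9_conjunct_of_model (Z11OfRecord F N (ζ.withSectG G)) G.valid G.D rfl G.hC₁ G.hβ₀ G.hδ₀ G.hB₅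

/-- **THE [B11] LEAF AT THE BUNDLE OF RECORD FROM THE EIGHT REMAINING PRINTED PARTS** (Props 2, 3, 4, 5, 6, 8, Sect. F — p9 NO LONGER AN INPUT) and n16's dictionary
inputs (bridges with their laws (15)–(18), the capped existence leaves, the Props 7–8 carriers' laws, the Sect. A law below a threshold `a`, `B₀ ≤ 4B₁`, `B₃ ≥ 1`,
`C₁ ≥ 1`): n07-a's `B11LeafKnitProp9.b11Leaf_of_parts_prop9Model` at `Z11OfRecord F N (ζ.withSectG G)` with `hfam := rfl`, `hV := rfl`.  Nothing of the series is
asserted. [cite: Balaban1985Variational, Thm 1 p.279, Props 2–9 pp.281–309] -/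
theorem b11Leaf_Z11OfRecord_withSectG_of_parts (ζ : ResidZ F N) (G : SectGPres F N 𝒴 𝒵 ζ)
    (βr : ∀ i, Bridge ((Z11OfRecord F N (ζ.withSectG G)).famX i) ((Z11OfRecord F N (ζ.withSectG G)).famLG i)) {O₁ O₂ e₅ a : ℝ}
    (laws : ∀ i, (βr i).Laws ζ.C₁ ζ.B₃) (leaves : ∀ i, ExistenceLeavesCap (βr i) ζ.B₀ ζ.B₃ ζ.C₁ O₁ O₂ e₅)
    (plaws : ∀ i, ((Z11OfRecord F N (ζ.withSectG G)).famX i).Laws)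
    (hB₀ : 0 < ζ.B₀) (hB₁ : 0 < ζ.B₁) (hB₃ : 1 ≤ ζ.B₃) (hC₁ : 1 ≤ ζ.C₁) (hB₀B₁ : ζ.B₀ ≤ 4 * ζ.B₁) (hc₁ : 0 < ζ.c₁)
    (hO₁ : 0 < O₁) (hO₂ : 0 < O₂) (he₅ : 0 < e₅) (ha : 0 < a)
    (hbg : ∀ (i : ZIdx) (ε₁ : ℝ) (V : ((Z11OfRecord F N (ζ.withSectG G)).famX i).Bdry), 0 < ε₁ → ε₁ ≤ a →
      ((Z11OfRecord F N (ζ.withSectG G)).famX i).Reg7 ε₁ V →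
        ∃ U₀ : ((Z11OfRecord F N (ζ.withSectG G)).famLG i).Cfg,
          ((Z11OfRecord F N (ζ.withSectG G)).famLG i).Sat14 (ζ.C₁ * ζ.B₃ * ε₁) (ζ.C₁ * ε₁) ((βr i).bdry V) U₀)
    (p2 : Prop2Printed ζ.B₁ ζ.B₃ ζ.C₁ ζ.c₁ ζ.famLG) (p3 : Prop3Printed ζ.C₁ ζ.B₃ ζ.C₂ ζ.C₃ ζ.B₀ ζ.c1h ζ.c₄ ζ.δ₀ ζ.famLG)
    (p4 : Prop4Printed ζ.C₁ ζ.B₃ ζ.famLG) (p5 : Prop5Printed ζ.B₁ ζ.B₃ ζ.C₁ ζ.famLG) (p6 : Prop6Printed ζ.B₀ ζ.B₃ ζ.C₁ ζ.famLG)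
    (p8 : Prop8Printed ζ.B₃ (famXOfRecord F N ζ)) (sF : SectFPrinted ζ.B₃ (famXOfRecord F N ζ)) :
    B11Leaf (Z11OfRecord F N (ζ.withSectG G)) :=
  B11LeafKnitProp9.b11Leaf_of_parts_prop9Model (Z11OfRecord F N (ζ.withSectG G)) βr laws leaves plaws hB₀ hB₁ hB₃ hC₁ hB₀B₁ hc₁ hO₁ hO₂ he₅ ha
    hbg rfl p2 p3 p4 p5 p6 p8 sF G.valid G.D rfl G.hC₁ G.hβ₀ G.hδ₀ G.hB₅

section WithE

variable {L : ℝ} {η : ZIdx → ℝ} [Fact (0 < L)] [∀ i, Fact (0 < η i)] {β : ZIdx → Type} [∀ i, Fintype (β i)]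

/-- At the doubly-presented bundle the Prop. 9 family is the Sect. G model family and the Props 2–6 family is the Sect. E family (`rfl` ×2).
[cite: Balaban1985Variational, Props 2–6 pp.281–296, Prop. 9 p.309 (bookkeeping)] -/
theorem Z11OfRecord_withSectEG_famLG_famAn (ζ : ResidZ F N) (E : SectEPres F N L η β ζ) (G : SectGPres F N 𝒴 𝒵 ζ) :
    (Z11OfRecord F N (ζ.withSectEG E G)).famLG = (fun i => (E.D i).toLGData (E.R i) (Z11OfRecord F N (ζ.withSectEG E G)).C₁) ∧
      (Z11OfRecord F N (ζ.withSectEG E G)).famAn = fun i => (G.D i).toAnData :=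
  ⟨rfl, rfl⟩

/-- **p9 at the doubly-presented bundle is a theorem** (§2's `prop9_Z11OfRecord_withSectG` at `ζ.withSectE E`). [cite: Balaban1985Variational, Prop. 9 p.309] -/
theorem prop9_Z11OfRecord_withSectEG (ζ : ResidZ F N) (E : SectEPres F N L η β ζ) (G : SectGPres F N 𝒴 𝒵 ζ) :
    Prop9Printed ζ.B₅ ζ.C₁ ζ.β₀ ζ.δ₀ (Z11OfRecord F N (ζ.withSectEG E G)).famAn :=
  prop9_Z11OfRecord_withSectG (ζ.withSectE E) (G.onWithSectE E)

/-- **p6 at the doubly-presented bundle is a theorem** (def-B11's `prop6_Z11OfRecord_withSectE` ∕ n16-d's `prop6_conjunct_of_sectE` BY NAME, `hZ := rfl`).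
[cite: Balaban1985Variational, Prop. 6 pp.295–296] -/
theorem prop6_Z11OfRecord_withSectEG (ζ : ResidZ F N) (E : SectEPres F N L η β ζ) (G : SectGPres F N 𝒴 𝒵 ζ)
    (hB₀ : 0 < ζ.B₀) (hC₄ : 0 < E.C₄) (ha₃ : 0 < E.a₃) (hB₃ : 0 < ζ.B₃) (hα : 0 < E.α) (hC₁ : 0 < ζ.C₁) :
    Prop6Printed ζ.B₀ ζ.B₃ ζ.C₁ (Z11OfRecord F N (ζ.withSectEG E G)).famLG :=
  B11LeafKnitSectE.prop6_conjunct_of_sectE (Z11OfRecord F N (ζ.withSectEG E G)) E.D E.R rfl hB₀ hC₄ ha₃ hB₃ hα hC₁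

omit [∀ i, Fintype (β i)] in
/-- **p4 at the doubly-presented bundle is a theorem** (def-B11's `prop4_Z11OfRecord_withSectE` ∕ n16-d's `prop4_conjunct_of_sectE` BY NAME).
[cite: Balaban1985Variational, Prop. 4 (97)–(98) pp.292–293] -/
theorem prop4_Z11OfRecord_withSectEG [∀ i, Fintype (β i)] (ζ : ResidZ F N) (E : SectEPres F N L η β ζ) (G : SectGPres F N 𝒴 𝒵 ζ)
    (hC₄ : 0 < E.C₄) (ha₃ : 0 < E.a₃) (hB₃ : 0 < ζ.B₃) (hα : 0 < E.α) (hC₁ : 0 < ζ.C₁) :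
    Prop4Printed ζ.C₁ ζ.B₃ (Z11OfRecord F N (ζ.withSectEG E G)).famLG :=
  B11LeafKnitSectE.prop4_conjunct_of_sectE (Z11OfRecord F N (ζ.withSectEG E G)) E.D E.R rfl hC₄ ha₃ hB₃ hα hC₁

/-- ★ **THE [B11] LEAF AT THE DOUBLY-PRESENTED BUNDLE OF RECORD FROM FIVE PRINTED STATEMENTS — Props 2, 3, 5 (over the Sect. E family), Prop 8 and Sect. F (over
the Props 7–8 family of record) — and n16's dictionary inputs** (bridges with their laws (15)–(18), the capped existence leaves of pp. 296–299 ∕ 301, the Props 7–8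
carriers' laws, the Sect. A law (12)–(14) below a threshold `a`, the printed relations `B₀ ≤ 4B₁`, `B₃ ≥ 1`, `C₁ ≥ 1`, the Sect. E letters' positivity): n16-d's
`B11LeafKnitSectE.b11Leaf_of_parts_sectE` at `Z11OfRecord F N (ζ.withSectEG E G)` with `hZ := rfl`, `hV := rfl` and `p9 := prop9_Z11OfRecord_withSectEG`.  p4, p6 AND
p9 ARE NO LONGER INPUTS; t1 and p7 are derived (p. 304's assembly inside `B11LeafKnit`).  Nothing of the series is asserted. [cite: Balaban1985Variational, Thm 1 p.279, Props 2–9 pp.281–309] -/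
theorem b11Leaf_Z11OfRecord_withSectEG_of_parts (ζ : ResidZ F N) (E : SectEPres F N L η β ζ) (G : SectGPres F N 𝒴 𝒵 ζ)
    (hC₄ : 0 < E.C₄) (ha₃ : 0 < E.a₃) (hα : 0 < E.α)
    (βr : ∀ i, Bridge ((Z11OfRecord F N (ζ.withSectEG E G)).famX i) ((Z11OfRecord F N (ζ.withSectEG E G)).famLG i)) {O₁ O₂ e₅ a : ℝ}
    (laws : ∀ i, (βr i).Laws ζ.C₁ ζ.B₃) (leaves : ∀ i, ExistenceLeavesCap (βr i) ζ.B₀ ζ.B₃ ζ.C₁ O₁ O₂ e₅)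
    (plaws : ∀ i, ((Z11OfRecord F N (ζ.withSectEG E G)).famX i).Laws)
    (hB₀ : 0 < ζ.B₀) (hB₁ : 0 < ζ.B₁) (hB₃ : 1 ≤ ζ.B₃) (hC₁ : 1 ≤ ζ.C₁) (hB₀B₁ : ζ.B₀ ≤ 4 * ζ.B₁) (hc₁ : 0 < ζ.c₁)
    (hO₁ : 0 < O₁) (hO₂ : 0 < O₂) (he₅ : 0 < e₅) (ha : 0 < a)
    (hbg : ∀ (i : ZIdx) (ε₁ : ℝ) (V : ((Z11OfRecord F N (ζ.withSectEG E G)).famX i).Bdry), 0 < ε₁ → ε₁ ≤ a →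
      ((Z11OfRecord F N (ζ.withSectEG E G)).famX i).Reg7 ε₁ V →
        ∃ U₀ : ((Z11OfRecord F N (ζ.withSectEG E G)).famLG i).Cfg,
          ((Z11OfRecord F N (ζ.withSectEG E G)).famLG i).Sat14 (ζ.C₁ * ζ.B₃ * ε₁) (ζ.C₁ * ε₁) ((βr i).bdry V) U₀)
    (p2 : Prop2Printed ζ.B₁ ζ.B₃ ζ.C₁ ζ.c₁ (Z11OfRecord F N (ζ.withSectEG E G)).famLG)
    (p3 : Prop3Printed ζ.C₁ ζ.B₃ ζ.C₂ ζ.C₃ ζ.B₀ ζ.c1h ζ.c₄ ζ.δ₀ (Z11OfRecord F N (ζ.withSectEG E G)).famLG)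
    (p5 : Prop5Printed ζ.B₁ ζ.B₃ ζ.C₁ (Z11OfRecord F N (ζ.withSectEG E G)).famLG)
    (p8 : Prop8Printed ζ.B₃ (famXOfRecord F N ζ)) (sF : SectFPrinted ζ.B₃ (famXOfRecord F N ζ)) :
    B11Leaf (Z11OfRecord F N (ζ.withSectEG E G)) :=
  B11LeafKnitSectE.b11Leaf_of_parts_sectE (Z11OfRecord F N (ζ.withSectEG E G)) E.D E.R rfl hC₄ ha₃ hα βr laws leaves plaws
    hB₀ hB₁ hB₃ hC₁ hB₀B₁ hc₁ hO₁ hO₂ he₅ ha hbg rfl p2 p3 p5 p8 sF (prop9_Z11OfRecord_withSectEG ζ E G)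

end WithE

end AtBundle

/-! ## §3. Non-vacuity by construction (a DEGENERATE datum, honest) and what the presentation does NOT close -/

section NonVacuity

/-- **Degenerate shared constants**: the bundle's `C₁, δ₀, β₀`, dimension `d = 4`, every operator letter `0`, cutting costs and row-sum constant `1`, `a₃ = A₀₂ = 1`
(so `q = 0 < 1` and the model's `B₅ = 2(λ + α) = 4`).  A consistency witness, NOT print's constants. [cite: Balaban1985Variational, Prop. 9 p.309 (bookkeeping: the presentation's type is inhabited)] -/
def zeroConsts (C₁ δ₀ β₀ : ℝ) : GConsts where
  d := 4
  C₁ := C₁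
  δ₀ := δ₀
  β₀ := β₀
  B₀ := 0
  C₄ := 0
  a₃ := 1
  AH0 := 0
  θ₂ := 0
  AH := 0
  C₂ := 0
  κB := 1
  κN := 1
  κ3 := 1
  c61 := 1
  BG := 0
  BG₂ := 0
  θW := 0
  cΔ := 0
  A₀ := 0
  A₀₂ := 1
  AH₂ := 0
  θD := 0

/-- The degenerate constants are `Valid` for `0 < C₁`, `0 ≤ δ₀`. [cite: Balaban1985Variational, Prop. 9 p.309 (bookkeeping)] -/
theorem zeroConsts_valid {C₁ δ₀ β₀ : ℝ} (hC₁ : 0 < C₁) (hδ₀ : 0 ≤ δ₀) : (zeroConsts C₁ δ₀ β₀).Valid where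
  C₁_pos := hC₁
  δ₀_nonneg := hδ₀
  B₀_nonneg := le_rfl
  C₄_nonneg := le_rfl
  a₃_pos := one_pos
  AH0_nonneg := le_rfl
  θ₂_nonneg := le_rfl
  AH_nonneg := le_rfl
  C₂_nonneg := le_rfl
  κB_nonneg := zero_le_one
  κN_nonneg := zero_le_one
  κ3_nonneg := zero_le_one
  c61_nonneg := zero_le_one
  BG_nonneg := le_rfl
  BG₂_nonneg := le_rfl
  θW_nonneg := le_rfl
  cΔ_nonneg := le_rfl
  A₀_nonneg := le_rfl
  A₀₂_pos := one_pos
  AH₂_nonneg := le_rfl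
  θD_nonneg := le_rfl
  q_lt_one := by norm_num [B11SectG.qG, B11SectG.thetaK, zeroConsts]

/-- The degenerate constants' model `B₅` is `4`. [cite: Balaban1985Variational, (173) p.305 (bookkeeping)] -/
theorem zeroConsts_B5 (C₁ δ₀ β₀ : ℝ) : (zeroConsts C₁ δ₀ β₀).B5 = 4 := by
  norm_num [GConsts.B5, GConsts.S, GConsts.lam, GConsts.alpha, GConsts.jcoef, zeroConsts]

variable (𝔄 ι 𝒴₀ 𝒵₀ Bdry : Type) [NormedRing 𝔄] [NormedAlgebra ℂ 𝔄] [CompleteSpace 𝔄] [Fintype ι]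
  [NormedAddCommGroup 𝒴₀] [NormedSpace ℂ 𝒴₀] [CompleteSpace 𝒴₀] [NormedAddCommGroup 𝒵₀] [NormedSpace ℂ 𝒵₀] [CompleteSpace 𝒵₀]

/-- **The DEGENERATE Sect. G datum** over ANY carriers: n07-b's one-site geometry `toyGeometry` (`𝔅 = {pt}`, `d ≡ 0`, `L = η = 1`), every operator `G̃, (δ/δA′)V, Δ⁽²⁾,
H₀, H, D` ZERO, every size the norm (`normBlockNorm`).  NOT Bałaban's operators — a consistency witness that the presentation's type is inhabited.
[cite: Balaban1985Variational, Prop. 9 p.309 (bookkeeping)] -/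
def zeroDatum (C₁ δ₀ β₀ : ℝ) : SectGDatum (zeroConsts C₁ δ₀ β₀) 𝔄 ι 𝒴₀ 𝒵₀ Bdry where
  g := toyGeometry
  𝒢 := fun _ => 0
  W := fun _ _ => 0
  D2 := fun _ => 0
  H₀ := fun _ => 0
  H := fun _ => 0
  D := fun _ _ => 0
  bB := normBlockNorm (ι → 𝔄)
  bN := normBlockNorm 𝒴₀
  b3 := normBlockNorm 𝒵₀
  bout := fun _ _ _ => normBlockNorm 𝒴₀
  L_pos := one_pos
  eta_pos := one_pos
  tri := fun _ _ _ => by show (0 : ℝ) ≤ 0 + 0; norm_num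
  dist_nonneg := fun _ _ => le_rfl
  rowSum := fun _ => by
    show ∑ _y' : Unit, Real.exp (-((zeroConsts C₁ δ₀ β₀).δ₀ / 8 * 0)) ≤ (zeroConsts C₁ δ₀ β₀).c61
    simp [zeroConsts]
  κB_eq := rfl
  κN_eq := rfl
  κ3_eq := rfl
  loc_le_norm := fun _ _ => le_rfl
  norm_le_loc := fun _ _ _ => le_rfl

variable {𝔄 ι 𝒴₀ 𝒵₀ Bdry}

/-- A map that is pointwise zero has every non-negative block majorant between norm sizes over the one-site geometry. [folklore] -/
private theorem hasMaj_norm_of_eq_zero {F₁ F₂ : Type} [NormedAddCommGroup F₁] [NormedSpace ℂ F₁] [NormedAddCommGroup F₂] [NormedSpace ℂ F₂]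
    (T : F₁ →ₗ[ℝ] F₂) (hT : ∀ μ, T μ = 0) {K : Unit → Unit → ℝ} (hK : ∀ a b, 0 ≤ K a b) :
    HasMaj (normBlockNorm F₁) (normBlockNorm F₂) T K := by
  intro y' μ _ y
  show ‖T μ‖ ≤ K y y' * ‖μ‖
  rw [hT μ, norm_zero]
  exact mul_nonneg (hK _ _) (norm_nonneg _)

/-- **Every located leaf holds for the degenerate datum, at every `V₀`** (zero operators have every non-negative majorant; the zero maps are analytic and satisfy the
quadratic bounds with constant `0`) — so at a layer presented by it the premise `Reg7 ε₁ V₀` of the presented p9 HOLDS and every conclusion of Proposition 9 is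
asserted of actual (degenerate) data: the theorem `prop9_Z11OfRecord_withSectG` is exercised, not vacuous. [cite: Balaban1985Variational, Prop. 9 p.309 (bookkeeping)] -/
theorem zeroDatum_letters {C₁ δ₀ β₀ : ℝ} (V₀ : Bdry) : (zeroDatum 𝔄 ι 𝒴₀ 𝒵₀ Bdry C₁ δ₀ β₀).Letters V₀ where
  norm_G := fun f => by simp [zeroDatum, zeroConsts]
  quad98 := fun Y _ => by simp [zeroDatum, zeroConsts]
  W_analytic := fun Y _ => by
    show AnalyticAt ℂ (fun _ : 𝒴₀ => (0 : 𝒵₀)) Y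
    exact analyticAt_const
  norm_H₀ := fun B => by simp [zeroDatum, zeroConsts]
  norm_D2 := fun Y => by simp [zeroDatum, zeroConsts]
  norm_H := fun B => by simp [zeroDatum, zeroConsts]
  D_analytic := fun Y _ => by
    show AnalyticAt ℂ (fun _ : 𝒴₀ => (0 : ι → 𝔄)) Y
    exact analyticAt_const
  norm_D := fun Y _ => by simp [zeroDatum, zeroConsts]
  maj73 := fun Y _ => by
    refine hasMaj_norm_of_eq_zero _ (fun μ => ?_) (fun _ _ => ?_)
    · show (fderiv ℂ (fun _ : 𝒴₀ => (0 : ι → 𝔄)) Y) μ = 0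
      simp
    · show (0 : ℝ) ≤ (zeroConsts C₁ δ₀ β₀).θD * Real.exp (-((zeroConsts C₁ δ₀ β₀).δ₀ / 2 * 0))
      simp [zeroConsts]
  maj189 := fun Y _ => by
    refine hasMaj_norm_of_eq_zero _ (fun μ => ?_) (fun _ _ => ?_)
    · show (fderiv ℂ (fun _ : 𝒴₀ => (0 : 𝒵₀)) Y) μ = 0
      simp
    · show (0 : ℝ) ≤ (zeroConsts C₁ δ₀ β₀).θW * Real.exp (-((zeroConsts C₁ δ₀ β₀).δ₀ / 4 * 0))
      simp [zeroConsts]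
  majG := hasMaj_norm_of_eq_zero _ (fun _ => rfl) (fun _ _ => by
    show (0 : ℝ) ≤ (zeroConsts C₁ δ₀ β₀).BG * Real.exp (-((zeroConsts C₁ δ₀ β₀).δ₀ * 0)); simp [zeroConsts])
  majG₂ := fun _ _ _ _ => hasMaj_norm_of_eq_zero _ (fun _ => rfl) (fun _ _ => by
    show (0 : ℝ) ≤ (zeroConsts C₁ δ₀ β₀).BG₂ * Real.exp (-((zeroConsts C₁ δ₀ β₀).δ₀ * 0)); simp [zeroConsts])
  majD2H0 := hasMaj_norm_of_eq_zero _ (fun _ => rfl) (fun _ _ => by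
    show (0 : ℝ) ≤ (zeroConsts C₁ δ₀ β₀).cΔ * Real.exp (-((zeroConsts C₁ δ₀ β₀).δ₀ * 0)); simp [zeroConsts])
  majH0 := hasMaj_norm_of_eq_zero _ (fun _ => rfl) (fun _ _ => by
    show (0 : ℝ) ≤ (zeroConsts C₁ δ₀ β₀).A₀ * Real.exp (-((zeroConsts C₁ δ₀ β₀).δ₀ * 0)); simp [zeroConsts])
  majH0₂ := fun _ _ _ _ => hasMaj_norm_of_eq_zero _ (fun _ => rfl) (fun _ _ => by
    show (0 : ℝ) ≤ (zeroConsts C₁ δ₀ β₀).A₀₂ * Real.exp (-((zeroConsts C₁ δ₀ β₀).δ₀ * 0)); simp [zeroConsts])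
  majH₂ := fun _ _ _ _ => hasMaj_norm_of_eq_zero _ (fun _ => rfl) (fun _ _ => by
    show (0 : ℝ) ≤ (zeroConsts C₁ δ₀ β₀).AH₂ * Real.exp (-((zeroConsts C₁ δ₀ β₀).δ₀ / 2 * 0)); simp [zeroConsts])

variable (F : T4Family) (N : ℕ)
variable (𝒴 𝒵 : ZIdx → Type) [∀ i, NormedAddCommGroup (𝒴 i)] [∀ i, NormedSpace ℂ (𝒴 i)] [∀ i, CompleteSpace (𝒴 i)]
  [∀ i, NormedAddCommGroup (𝒵 i)] [∀ i, NormedSpace ℂ (𝒵 i)] [∀ i, CompleteSpace (𝒵 i)]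

variable {F N 𝒴 𝒵} in
/-- **The degenerate presentation** of a layer with `0 < C₁`, `0 ≤ δ₀`, `4 ≤ B₅`: constants `zeroConsts ζ.C₁ ζ.δ₀ ζ.β₀`, the degenerate datum at every member.
[cite: Balaban1985Variational, Prop. 9 p.309 (bookkeeping: the presentation's type is inhabited)] -/
def zeroSectGPres (ζ : ResidZ F N) (hC₁ : 0 < ζ.C₁) (hδ₀ : 0 ≤ ζ.δ₀) (hB₅ : (4 : ℝ) ≤ ζ.B₅) : SectGPres F N 𝒴 𝒵 ζ where
  q := zeroConsts ζ.C₁ ζ.δ₀ ζ.β₀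
  valid := zeroConsts_valid hC₁ hδ₀
  hC₁ := rfl
  hβ₀ := rfl
  hδ₀ := rfl
  hB₅ := (zeroConsts_B5 ζ.C₁ ζ.δ₀ ζ.β₀).le.trans hB₅
  D := fun i => zeroDatum (Matrix (Fin N) (Fin N) ℂ) (PBond (F.P i.K) i.k) (𝒴 i) (𝒵 i) (GaugeField (F.P i.K) i.k (SU N)) ζ.C₁ ζ.δ₀ ζ.β₀

variable {F N 𝒴 𝒵} in
/-- **NON-VACUITY BY NAME**: every residual layer with `0 < C₁`, `0 ≤ δ₀` and `4 ≤ B₅` (print: `C₁ = L³`, `δ₀ > 0`, `B₅ = 6B₁B₃C₁`) ADMITS a Sect. G presentation at NODE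
00's objects, for every choice of the spaces — the degenerate one (honest: NOT Bałaban's operators). [cite: Balaban1985Variational, Prop. 9 p.309, (173) p.305 (bookkeeping)] -/
theorem exists_sectGPres (ζ : ResidZ F N) (hC₁ : 0 < ζ.C₁) (hδ₀ : 0 ≤ ζ.δ₀) (hB₅ : (4 : ℝ) ≤ ζ.B₅) : Nonempty (SectGPres F N 𝒴 𝒵 ζ) :=
  ⟨zeroSectGPres ζ hC₁ hδ₀ hB₅⟩

variable {F N 𝒴 𝒵} in
/-- … and at the degenerate presentation the premise of the presented p9 holds at every member, every `ε₁`, every `V₀` (the presented Proposition 9 is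
exercised). [cite: Balaban1985Variational, Prop. 9 p.309 (bookkeeping)] -/
theorem reg7_zeroSectGPres (ζ : ResidZ F N) (hC₁ : 0 < ζ.C₁) (hδ₀ : 0 ≤ ζ.δ₀) (hB₅ : (4 : ℝ) ≤ ζ.B₅) (i : ZIdx) (ε₁ : ℝ)
    (V₀ : GaugeField (F.P i.K) i.k (SU N)) : ((ζ.withSectG (zeroSectGPres (𝒴 := 𝒴) (𝒵 := 𝒵) ζ hC₁ hδ₀ hB₅)).famAn i).Reg7 ε₁ V₀ :=
  zeroDatum_letters V₀

section WithE

variable {L : ℝ} {η : ZIdx → ℝ} [Fact (0 < L)] [∀ i, Fact (0 < η i)] (β : ZIdx → Type) [∀ i, Fintype (β i)]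

variable {F N 𝒴 𝒵} in
/-- **Both presentations at once**: every residual layer with `0 ≤ B₀`, `4L ≤ B₃`, `0 < C₁`, `0 ≤ δ₀`, `4 ≤ B₅` admits def-B11's Sect. E presentation AND a Sect. G
presentation (`CarriersZSectE.exists_sectEPres` + `exists_sectGPres`). [cite: Balaban1985Variational, Props 2–9 pp.281–309 (bookkeeping)] -/
theorem exists_sectEPres_and_sectGPres (ζ : ResidZ F N) (hB₀ : 0 ≤ ζ.B₀) (hB₃ : (4 : ℝ) * L ≤ ζ.B₃) (hC₁ : 0 < ζ.C₁) (hδ₀ : 0 ≤ ζ.δ₀)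
    (hB₅ : (4 : ℝ) ≤ ζ.B₅) : Nonempty (SectEPres F N L η β ζ) ∧ Nonempty (SectGPres F N 𝒴 𝒵 ζ) :=
  ⟨exists_sectEPres ζ hB₀ hB₃, exists_sectGPres ζ hC₁ hδ₀ hB₅⟩

end WithE

section Honesty

variable [NeZero N]

/-- **THE JUNK CHANNEL OF THE ∀-FORM SURVIVES THE PRESENTATION** (honesty; cf. `CarriersZ.exists_residZ_not_b11Leaf`, `CarriersZSectE.exists_withSectE_not_b11Leaf`): a
residual layer whose regularity data of (9)–(10) has, at every member, ONE cube of size parameter `0` that is never gaugeable — constants `C₁ := 1`, `δ₀ := 0`,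
`B₅ := 4` so that it carries a Sect. G presentation (§3's degenerate one) — STILL makes the leaf fail through its conjunct `t1` (Theorem 1 at the member `K = k = 0`,
`V := 1`, n07-a's `reg7_one`).  So this module does NOT make N07 bookable in ∀-form over a record exposing presented layers; an object-level pin of `R` (F8) would.
[cite: Balaban1985Variational, Thm 1 (9)–(10) p.279 (bookkeeping: the typed regularity clause reads the residual data)] -/
theorem exists_withSectG_not_b11Leaf : ∃ (ζ : ResidZ F N) (G : SectGPres F N 𝒴 𝒵 ζ), ¬ B11Leaf (Z11OfRecord F N (ζ.withSectG G)) := by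
  let Rbad : ∀ K : ℕ, RegCarrierT F N K := fun _ =>
    ⟨PUnit, fun _ => 0, fun _ => 0, fun _ _ => False, fun _ _ => 0, fun _ _ => 0, fun _ _ _ => 0, fun _ _ => 0⟩
  let ζ₀ : ResidZ F N := Classical.choice (nonempty_residZ F N)
  let ζ : ResidZ F N := { ζ₀ with R := fun i => Rbad i.K, C₁ := 1, δ₀ := 0, B₅ := 4 }
  refine ⟨ζ, zeroSectGPres ζ one_pos le_rfl le_rfl, fun hZ => ?_⟩
  obtain ⟨C, hC⟩ := exists_thm1At_of_b11Leaf_Z11OfRecord hZ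
  obtain ⟨h8, -, h910⟩ :=
    hC ⟨0, 0, le_rfl⟩ C.a₁ C.a₁_pos le_rfl (1 : GaugeField (F.P 0) 0 (SU N)) (B11Thm1CarrierT.reg7_one (Rbad 0) C.a₁_pos)
  obtain ⟨U, -, -, hU⟩ := h8
  exact (h910 U hU PUnit.unit (C.Mfun_pos C.a₁ C.a₁_pos).le).1

section WithE

variable {L : ℝ} {η : ZIdx → ℝ} [Fact (0 < L)] [∀ i, Fact (0 < η i)] (β : ZIdx → Type) [∀ i, Fintype (β i)]

/-- **… and survives BOTH presentations**: constants `B₀ := 0`, `B₃ := 4L`, `C₁ := 1`, `δ₀ := 0`, `B₅ := 4` carry a Sect. E AND a Sect. G presentation, and the same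
never-gaugeable cube kills `t1`. [cite: Balaban1985Variational, Thm 1 (9)–(10) p.279 (bookkeeping)] -/
theorem exists_withSectEG_not_b11Leaf :
    ∃ (ζ : ResidZ F N) (E : SectEPres F N L η β ζ) (G : SectGPres F N 𝒴 𝒵 ζ), ¬ B11Leaf (Z11OfRecord F N (ζ.withSectEG E G)) := by
  let Rbad : ∀ K : ℕ, RegCarrierT F N K := fun _ =>
    ⟨PUnit, fun _ => 0, fun _ => 0, fun _ _ => False, fun _ _ => 0, fun _ _ => 0, fun _ _ _ => 0, fun _ _ => 0⟩
  let ζ₀ : ResidZ F N := Classical.choice (nonempty_residZ F N)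
  let ζ : ResidZ F N := { ζ₀ with R := fun i => Rbad i.K, B₀ := 0, B₃ := 4 * L, C₁ := 1, δ₀ := 0, B₅ := 4 }
  have hE : Nonempty (SectEPres F N L η β ζ) := exists_sectEPres ζ le_rfl le_rfl
  refine ⟨ζ, Classical.choice hE, zeroSectGPres ζ one_pos le_rfl le_rfl, fun hZ => ?_⟩
  obtain ⟨C, hC⟩ := exists_thm1At_of_b11Leaf_Z11OfRecord hZ
  obtain ⟨h8, -, h910⟩ :=
    hC ⟨0, 0, le_rfl⟩ C.a₁ C.a₁_pos le_rfl (1 : GaugeField (F.P 0) 0 (SU N)) (B11Thm1CarrierT.reg7_one (Rbad 0) C.a₁_pos)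
  obtain ⟨U, -, -, hU⟩ := h8
  exact (h910 U hU PUnit.unit (C.Mfun_pos C.a₁ C.a₁_pos).le).1

end WithE

end Honesty

end NonVacuity

end Literature.MathematicalPhysics.QuantumFieldTheory.Balaban1983to89.Node00

end
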